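import Summits.BirchSwinnertonDyer.Rank1Residual.ManinAdditive.PlusIndexLaws
import Summits.BirchSwinnertonDyer.Rank1Residual.ManinAdditive.RelativeIharaShiftVanishingParabolic
import HarnessLib
import HarnessLib.Audit.Tags

/-!
# The NON-TRIVIALLY-EISENSTEIN LOCALISATION of the 3-adic polar witness: `NotTrivialEisensteinModThreeAt` (hNT₃),
# candidates E-es-69 `ThreeAdicWitnessOfNotTrivialEisenstein`, E-es-69♮/♭/♯, E-es-40₃, the two habitat cuts of E-es-61, and
# their edges (es g19, MEMO-es §32) — cell `bsd-f2-manin` (D-0131 (3) frontier: the Manin constant at additive primes);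
# sibling of `PlusIndexLaws` / `KatoCurvePlusDefect` / `NotTrivialEisensteinOfIrreducible`

HONEST FRAMING.  LENS = Euler systems / explicit reciprocity (planner `bsd-f2-manin-es` g19; HOME
`run/shared/lean/pub/bsd-f2-manin/MEMO-es.md` §32 (32.2 the rows, 32.4 the `p = 3` parabolic relative-Ihara inputs)).  Source:
HOME/es/Sketch-es-g19.lean sha16 **9a52af07ffee6b73** (187 l., farm rc 0 · 0 sorries per es; es's own BC7 battery 7/7 CLEAN,
raw HOME/es/g19-bc7{,b}.raw2.txt, g19-bc7c.raw.txt), §1–§3 copied VERBATIM (namespace `BsdF2ManinEsG19` ↦ `…ManinAdditive.KatoCurve`,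
the namespace of `PlusIndexLaws` whose rows E-es-66 / E-es-67♯ the edges consume BY NAME) with exactly these deviations, all
recorded at the declaration: (i) `@[conjecture]` on the seven closed `Prop` rows (E-es-69, 69♮, 69♭, 69♯, E-es-40₃ and the two cuts
of E-es-61 — nothing is asserted; es calls 69♮/69♭/69♯/40₃ THEOREM-candidates on paper); (ii) `[cite: …]` tags added where the
sketch had none (E-es-69: the nearest prior art named by es for placement P-es-12; the cuts: E-es-61's own tag), in the tree's
«shape only … NOT in print» format; (iii) `import HarnessLib.Audit.Tags`; (iv) §4 of the sketch (the two `abbrev`s naming the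
EXISTING instances `RelativeIharaShiftVanishingParOdd 3 3 1` / `RelativeIharaShiftVanishingParOddExact 3 q 1`) is NOT copied —
es asked for §1–§3, and the instances are tree declarations already (`RelativeIharaShiftVanishingParabolic`).  Filed at es's
request T-es-24 (HOME/INBOX.md 2026-08-28T16:05:40Z, MEDIUM) by the cell typer (g13).  REFUTER VERDICTS AT FILING: REF1 R-es-38
(audit of MEMO-es §32) PENDING; by-name statement audit of the seven rows REQUESTED with this filing; REF2 placement P-es-12
(Diamond–Ribet 1997 Lemma 4.6; Mazur 1977 for the Eisenstein-ideal shape) PENDING.  A finding is repaired under a NEW name in this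
file (append-only).  bears_on: stmt-BirchSwinnertonDyer-22968 (C3 `ManinPrimeToThreeAtNine`: E-es-61 / RES₃♭ habitat).
Beyond-print theorem: no.  BSD is not proved by this; Manin's conjecture is not proved by this; C3 is not closed by this.

ES g19 TEXT (VERBATIM):
# es g19 (cell bsd-f2-manin, MEMO-es §32): the NON-TRIVIALLY-EISENSTEIN LOCALISATION of the 3-adic polar witness.

For an optimal `W` with `9 ∣ N` whose mod-`3` Hecke eigen-system `λ_W(T_r) = a_r(W) mod 3` is hNT(3)-non-trivial
(`∀ M, ∃ r ≡ 1 (3^M)` good with `a_r ≢ r + 1 (mod 3)`; for `W[3]` reducible with kernel character `ψ` this is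
`ψ ∉ {1, χ₋₃}`, i.e. neither a rational `3`-torsion point nor `μ₃` in the class' semisimplification), the plus functional
`φ⁺ mod 3` is a non-zero PARABOLIC Hecke-eigen class in `H¹(Γ₀(N), 𝔽₃)[λ_W]`; by the parabolic relative-Ihara statements
E-es-36o(3,3,1) / E-es-36x(3,q,1) (leaf `RelativeIharaShiftVanishingParabolic`, instances of EXISTING decls) it cannot be
annihilated by the iterated degeneracy push-forward `(B₃−B₁)_* ∘ ∏_{q ∥ N hole} (B_q−B₁)_*`, whose image is spanned (prime-class
generation `two_mul_mem_closure_primeClass_admissibleThree`, a THEOREM) by HOLE-AVOIDING shift combinations of prime classes at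
admissible conductors `m ≡ 11 (12)`; Fourier inversion on `A_m` (odd order prime to 3) and the Euler-factor bookkeeping of
THM R (L3/L4, REF1 §R67 VALID) then give an allowed even `χ` with `v_𝔓(e_S(χ)·Λ(f,χ̄,1)/Ω⁺) = 0`, i.e. `ThreeAdicPolarWitness W W f`
— WITHOUT the generation law GEN⋆₃ / the plus index (E-es-66) and without `W[3]` irreducible.

Nothing here is asserted as true: `@[conjecture]`-style `def … : Prop` only, plus trivial edges.  Census E43
(HOME/es/E43-HNT-LOCALISATION-lt100000-v1.tsv 602be922b6c9337a, 127 050 classes `9 ∣ N < 10⁵`, two engines for the hNT column: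
point counts vs Sutherland's galrep labels, 0 disagreements): of the 9 567 classes with `W[3]` reducible and no rational `3`-torsion on
the optimal curve (the RES₃ habitat), 6 186 are hNT-generic (E-es-69 applies; 601 of 1 109 below 10⁴), 3 381 are the `μ₃ ⊂ W` residue,
0 are «Eisenstein pair without torsion or μ₃», 0 fail hNT at a hole prime `q ∥ N` (Tate: impossible).  Falsifier: all 13 generic classes
in the exact 3-adic witness table E38 (`N ≤ 600`) carry a unit witness (gA = 0); A₃-proxy (E42c) 601/601 below 10⁴.
-/

set_option autoImplicit false

noncomputable section

open scoped Classical MatrixGroups ModularForm ComplexConjugate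

open CongruenceSubgroup Complex WeierstrassCurve Literature.NumberTheory.EllipticCurves
  Literature.NumberTheory.EllipticCurves.ModularForms
  Summit.BirchSwinnertonDyer.Rank1Residual.ManinAdditive
  Summit.BirchSwinnertonDyer.Rank1Residual.ManinAdditive.CuspidalKummer
  Summit.BirchSwinnertonDyer.Rank1Residual.ManinAdditive.CuspidalKummerThree

namespace Summit.BirchSwinnertonDyer.Rank1Residual.ManinAdditive.KatoCurve


/-! ### §1. hNT(t) for the mod-3 eigen-system of a curve (f-free, isogeny-invariant) -/

/-- **hNT₃(t)**: the mod-`3` Hecke eigen-system `r ↦ a_r(W) mod 3` is NOT trivially Eisenstein on the classes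
`r ≡ 1 (mod t^M)`: for every finite `S` and every `M` some prime `r ∉ S`, `r ≡ 1 (t^M)`, has `a_r(W) ≢ r + 1 (mod 3)`.
(For `t = 3` and `W[3]` reducible with kernel character `ψ`: `⟺ ψ ∉ {1, χ₋₃}`; decided by ONE good prime `ℓ ≡ 1 (3)` with
`a_ℓ ≡ 1 (3)`, census E43 column `pair`.) Same binder shape as the tree's E-es-40 `NotTrivialEisensteinOfIrreducibleTwo`. -/
def NotTrivialEisensteinModThreeAt (W : WeierstrassCurve ℚ) [W.IsElliptic] (t : ℕ) : Prop :=
  ∀ (S : Finset ℕ) (M : ℕ), ∃ r : ℕ, r.Prime ∧ r ∉ S ∧ r ≡ 1 [MOD t ^ M] ∧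
    (((W.LFunction r : ℤ) : ZMod 3)) ≠ (r : ZMod 3) + 1

/-! ### §2. E-es-69 — the localisation law (THEOREM-candidate modulo E-es-36o(3,3,1), E-es-36x(3,q,1), PCG₃, dictionary) -/

/-- **E-es-69 `ThreeAdicWitnessOfNotTrivialEisenstein`** (es g19, MEMO-es §32): for the optimal curve `W` (lattice-optimal
datum `D`), `9 ∣ N`, if `λ_W mod 3` is hNT(3)-non-trivial and hNT(q)-non-trivial at every `q ∥ N`, `q ≠ 3` (automatic from
hNT(3) by Tate's uniformisation, E-es-69♮), then a `3`-adic even polar UNIT witness against `Ω(W)` exists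
(`ThreeAdicPolarWitness W W D.f`: allowed `χ` of prime-to-3 order, `χ(3) ≠ ±1`, `e_S(χ)·S_χ = r·Ω⁺`, `s·r/3 ∉ ℤ̄` for `3 ∤ s`).
Mechanism: `φ⁺ mod 3 ≠ 0` is parabolic `λ_W`-eigen; iterated degeneracy test + E-es-36o(3,3,1)/36x(3,q,1) + prime-class
generation at `m ≡ 11 (12)` + THM R L3/L4.  Replaces the LAW E-es-66 (plus index / GEN⋆₃) on the hNT-generic locus.
BC5: E43 601/601 generic classes `9 ∣ N < 10⁴` carry gA = 0 in E38/E28 where computed (56/56 ≤ 300, 30/30 ≤ 600); 0 hole failures.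
Cell bsd-f2-manin row E-es-69; typed VERBATIM from HOME/es/Sketch-es-g19.lean 9a52af07ffee6b73 (typer g13, T-es-24); REF1 R-es-38: PENDING at filing; nothing asserted.
[cite: DiamondRibet1997, Lemma 4.6 (shape only: non-Eisenstein localisation of the cohomology of `X₀(N)` and Ihara-type injectivity — the nearest prior art named by es for placement P-es-12; the hNT-localised 3-adic polar unit-witness law is the cell's E-es-69, NOT in print — MEMO-es §32.2; census E43 601/601)] -/
@[conjecture]
def ThreeAdicWitnessOfNotTrivialEisenstein : Prop :=
  ∀ (W : WeierstrassCurve ℚ) [W.IsElliptic] [W.IsGloballyMinimal] {N : ℕ} [NeZero N]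
    (D : ModularParametrizationData W N),
    (∀ z ∈ D.L.lattice, ∃ w ∈ periodLattice D.f, z = D.c * w) → 3 ^ 2 ∣ N →
    NotTrivialEisensteinModThreeAt W 3 →
    (∀ q ∈ N.primeFactors, q ≠ 3 → ¬ q ^ 2 ∣ N → NotTrivialEisensteinModThreeAt W q) →
    ThreeAdicPolarWitness W W D.f

/-- **E-es-69♮ `notTrivialEisensteinModThree_multiplicative`** (THEOREM-candidate; Tate curve + Dirichlet): at a prime
`q ∥ N`, `q ≠ 3`, the semisimplified mod-`3` representation is UNRAMIFIED at `q`, so its characters have conductor prime to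
`q` and hNT(3) ⟹ hNT(q).  Census E43: 0 / 601 generic classes fail at a hole prime.
[cite: DarmonDiamondTaylor1995, Prop. 2.12 (c) p. 58 (shape only: `ρ̄|_{G_q}` at a multiplicative prime; the hNT transfer is the cell's)]
Cell bsd-f2-manin row E-es-69♮; typed VERBATIM from HOME/es/Sketch-es-g19.lean 9a52af07ffee6b73 (typer g13, T-es-24); REF1 R-es-38: PENDING at filing; nothing asserted.
-/
@[conjecture]
def NotTrivialEisensteinModThreeMultiplicative : Prop :=
  ∀ (W : WeierstrassCurve ℚ) [W.IsElliptic] {N : ℕ} [NeZero N] (f : CuspForm (Gamma0 N) 2),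
    IsNewformOf W f → NotTrivialEisensteinModThreeAt W 3 →
    ∀ q ∈ N.primeFactors, q ≠ 3 → ¬ q ^ 2 ∣ N → NotTrivialEisensteinModThreeAt W q

/-- **E-es-69♭ `notTrivialEisensteinModThree_of_witnessPrime`** (THEOREM-candidate; Dirichlet for the quadratic kernel
character): for `W[3]` reducible ONE good prime `ℓ ≡ 1 (mod 3)` with `a_ℓ(W) ≡ 1 (mod 3)` (i.e. `ψ(ℓ) = −1`) gives hNT(3)
(`ψ·{1,χ₋₃}` has conductor not a power of 3, so `ψ = −1` on infinitely many `r ≡ 1 (3^M)`).  This is the census test E43 `pair`.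
[cite: DarmonDiamondTaylor1995, Prop. 2.11 (a) p. 57 (shape only: `tr ρ̄(Frob_ℓ) = a_ℓ`; the one-prime criterion is the cell's)]
Cell bsd-f2-manin row E-es-69♭; typed VERBATIM from HOME/es/Sketch-es-g19.lean 9a52af07ffee6b73 (typer g13, T-es-24); REF1 R-es-38: PENDING at filing; nothing asserted.
-/
@[conjecture]
def NotTrivialEisensteinModThreeOfWitnessPrime : Prop :=
  ∀ (W : WeierstrassCurve ℚ) [W.IsElliptic] {N : ℕ} [NeZero N] (f : CuspForm (Gamma0 N) 2),
    IsNewformOf W f → ¬ W.HasIrreducibleModPGaloisRep 3 →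
    (∃ ℓ : ℕ, ℓ.Prime ∧ ¬ ℓ ∣ 3 * N ∧ ℓ % 3 = 1 ∧ (((W.LFunction ℓ : ℤ) : ZMod 3)) = 1) →
    NotTrivialEisensteinModThreeAt W 3

/-- **E-es-69♯ `notTrivialEisensteinModThree_of_noThreeTorsion_of_noMuThree`** (THEOREM-candidate; the RESIDUE
IDENTIFICATION): for `W[3]` reducible, optimal datum, no rational `3`-torsion point and `W ⊉ μ₃`, the kernel character is
`∉ {1, χ₋₃}`, hence hNT(3).  Census E43 sanity S2: `pair = eis ⟺ (tors3 ∨ mu3)` on 1 648 / 1 648 reducible classes `9 ∣ N < 10⁴`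
(galrep cross-check S3: `eis ⟺ 3B.1.1 / 3B.1.2 / 3Cs.1.1`, 1 648 / 1 648).
[cite: DarmonDiamondTaylor1995, Prop. 2.11 (a) p. 57 (shape only; the identification `ψ ∈ {1,χ₋₃} ⟺ 3-torsion or μ₃` is the cell's, MEMO-es §32.3)]
Cell bsd-f2-manin row E-es-69♯; typed VERBATIM from HOME/es/Sketch-es-g19.lean 9a52af07ffee6b73 (typer g13, T-es-24); REF1 R-es-38: PENDING at filing; nothing asserted.
-/
@[conjecture]
def NotTrivialEisensteinModThreeOfNoThreeTorsionOfNoMuThree : Prop :=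
  ∀ (W : WeierstrassCurve ℚ) [W.IsElliptic] [W.IsGloballyMinimal] {N : ℕ} [NeZero N]
    (D : ModularParametrizationData W N),
    (∀ z ∈ D.L.lattice, ∃ w ∈ periodLattice D.f, z = D.c * w) → ¬ W.HasIrreducibleModPGaloisRep 3 →
    (∀ X₀ Y₀ : ℚ, ¬ IsShortThreeTorsion W D.c X₀ Y₀) → ¬ HasShortMuThree W D.c →
    NotTrivialEisensteinModThreeAt W 3

/-! ### §3. The habitat cut of E-es-61 and the edges (all PROVED, pure logic) -/

/-- E-es-61 restricted to `W ⊉ μ₃` (the hNT-generic cut of RES₃♭; 601 / 1 109 classes `9 ∣ N < 10⁴`).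
Cell bsd-f2-manin row E-es-61 (generic cut); typed VERBATIM from HOME/es/Sketch-es-g19.lean 9a52af07ffee6b73 (typer g13, T-es-24); REF1 R-es-38: PENDING at filing; nothing asserted.
[cite: Kato2004Asterisque, Thm. 6.6 (1) (p. 163) (shape only; the `W ⊉ μ₃` cut of the cell's unit-witness law E-es-61, NOT in print — MEMO-es §29.5 / §32.2)] -/
@[conjecture]
def ThreeAdicUnitWitnessOfNoRationalThreeTorsionOfNoMuThree : Prop :=
  ∀ (W : WeierstrassCurve ℚ) [W.IsElliptic] [W.IsGloballyMinimal] {N : ℕ} [NeZero N]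
    (D : ModularParametrizationData W N),
    (∀ z ∈ D.L.lattice, ∃ w ∈ periodLattice D.f, z = D.c * w) → 3 ^ 2 ∣ N →
    (∀ X₀ Y₀ : ℚ, ¬ IsShortThreeTorsion W D.c X₀ Y₀) → ¬ HasShortMuThree W D.c → ThreeAdicPolarWitness W W D.f

/-- E-es-61 restricted to `W ⊇ μ₃` (the residue; 508 / 1 109 classes), = E-es-66 ∘ E-es-67♯ by name below.
Cell bsd-f2-manin row E-es-61 (μ₃ residue cut); typed VERBATIM from HOME/es/Sketch-es-g19.lean 9a52af07ffee6b73 (typer g13, T-es-24); REF1 R-es-38: PENDING at filing; nothing asserted.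
[cite: Kato2004Asterisque, Thm. 6.6 (1) (p. 163) (shape only; the `W ⊇ μ₃` cut of the cell's unit-witness law E-es-61 = E-es-66 ∘ E-es-67♯ by name, NOT in print — MEMO-es §29.5 / §32.2)] -/
@[conjecture]
def ThreeAdicUnitWitnessOfNoRationalThreeTorsionOfMuThree : Prop :=
  ∀ (W : WeierstrassCurve ℚ) [W.IsElliptic] [W.IsGloballyMinimal] {N : ℕ} [NeZero N]
    (D : ModularParametrizationData W N),
    (∀ z ∈ D.L.lattice, ∃ w ∈ periodLattice D.f, z = D.c * w) → 3 ^ 2 ∣ N →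
    (∀ X₀ Y₀ : ℚ, ¬ IsShortThreeTorsion W D.c X₀ Y₀) → HasShortMuThree W D.c → ThreeAdicPolarWitness W W D.f

/-- **EDGE 1 (PROVED)**: on the irreducible-or-generic locus E-es-69 + E-es-69♮ give the witness from hNT(3) alone. -/
theorem threeAdicPolarWitness_of_hNT (h69 : ThreeAdicWitnessOfNotTrivialEisenstein)
    (h69n : NotTrivialEisensteinModThreeMultiplicative)
    (W : WeierstrassCurve ℚ) [W.IsElliptic] [W.IsGloballyMinimal] {N : ℕ} [NeZero N]
    (D : ModularParametrizationData W N)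
    (hopt : ∀ z ∈ D.L.lattice, ∃ w ∈ periodLattice D.f, z = D.c * w) (h9 : 3 ^ 2 ∣ N)
    (hNT : NotTrivialEisensteinModThreeAt W 3) : ThreeAdicPolarWitness W W D.f :=
  h69 W D hopt h9 hNT (h69n W D.f D.isNewformOf hNT)

/-- **E-es-40₃ `NotTrivialEisensteinModThreeOfIrreducible`** (THEOREM-candidate by Chebotarev, the `p = 3` twin of the
tree's E-es-40₂): for `W[3]` irreducible, hNT(3) holds (if every element of `ρ̄(Gal(ℚ̄/ℚ(ζ_{3^M})))` had trace `2 = 1 + r` it would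
be a `3`-group fixing a unique line, stable under the whole image — reducible; if trivial, the image is abelian and contains complex
conjugation — reducible).  Not needed on the reducible locus; recorded so that EDGE 2 has no ad-hoc binder.
[cite: DarmonDiamondTaylor1995, Prop. 2.11 (a) p. 57 (shape only: `tr ρ̄(Frob_r) = a_r`; the `3`-power congruence-class statement is a Chebotarev consequence NOT in print as such)]
Cell bsd-f2-manin row E-es-40₃; typed VERBATIM from HOME/es/Sketch-es-g19.lean 9a52af07ffee6b73 (typer g13, T-es-24); REF1 R-es-38: PENDING at filing; nothing asserted.
-/
@[conjecture]
def NotTrivialEisensteinModThreeOfIrreducible : Prop :=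
  ∀ (W : WeierstrassCurve ℚ) [W.IsElliptic], W.HasIrreducibleModPGaloisRep 3 → NotTrivialEisensteinModThreeAt W 3

/-- **EDGE 2 (PROVED)**: the generic cut of E-es-61 from E-es-69, E-es-69♮, the residue identification E-es-69♯ and E-es-40₃ —
no generation law, no plus index. -/
theorem threeAdicUnitWitness_noMuThree_of_laws (h69 : ThreeAdicWitnessOfNotTrivialEisenstein)
    (h69n : NotTrivialEisensteinModThreeMultiplicative)
    (h69s : NotTrivialEisensteinModThreeOfNoThreeTorsionOfNoMuThree)
    (h40 : NotTrivialEisensteinModThreeOfIrreducible) :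
    ThreeAdicUnitWitnessOfNoRationalThreeTorsionOfNoMuThree := by
  intro W _ _ N _ D hopt h9 hT hmu
  by_cases hirr : W.HasIrreducibleModPGaloisRep 3
  · exact threeAdicPolarWitness_of_hNT h69 h69n W D hopt h9 (h40 W hirr)
  · exact threeAdicPolarWitness_of_hNT h69 h69n W D hopt h9 (h69s W D hopt hirr hT hmu)

/-- **EDGE 2′ (PROVED)**: the whole of E-es-61 from the four hNT rows plus the residue LAW pair E-es-66 ∘ E-es-67♯. -/
theorem threeAdicUnitWitnessOfNoRationalThreeTorsion_of_hNT_laws (h69 : ThreeAdicWitnessOfNotTrivialEisenstein)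
    (h69n : NotTrivialEisensteinModThreeMultiplicative)
    (h69s : NotTrivialEisensteinModThreeOfNoThreeTorsionOfNoMuThree)
    (h40 : NotTrivialEisensteinModThreeOfIrreducible)
    (h66 : ThreeAdicWitnessOfPlusIndexPrimeToThree) (h67s : PlusIndexPrimeToThreeOfMuThreeNoRationalThreeTorsion) :
    ThreeAdicUnitWitnessOfNoRationalThreeTorsion := by
  intro W _ _ N _ D hopt h9 hT
  by_cases hmu : HasShortMuThree W D.c
  · exact h66 W D hopt h9 (h67s W D hopt h9 hmu hT)
  · exact threeAdicUnitWitness_noMuThree_of_laws h69 h69n h69s h40 W D hopt h9 hT hmu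

/-- **EDGE 3 (PROVED)**: the residue cut is E-es-66 ∘ E-es-67♯ BY NAME (tree `PlusIndexLaws`). -/
theorem threeAdicUnitWitness_muThree_of_laws (h66 : ThreeAdicWitnessOfPlusIndexPrimeToThree)
    (h67s : PlusIndexPrimeToThreeOfMuThreeNoRationalThreeTorsion) :
    ThreeAdicUnitWitnessOfNoRationalThreeTorsionOfMuThree := by
  intro W _ _ N _ D hopt h9 hT hmu
  exact h66 W D hopt h9 (h67s W D hopt h9 hmu hT)

/-- **EDGE 4 (PROVED)**: E-es-61 = generic cut ∧ residue cut. -/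
theorem threeAdicUnitWitnessOfNoRationalThreeTorsion_of_cuts
    (hgen : ThreeAdicUnitWitnessOfNoRationalThreeTorsionOfNoMuThree)
    (hres : ThreeAdicUnitWitnessOfNoRationalThreeTorsionOfMuThree) :
    ThreeAdicUnitWitnessOfNoRationalThreeTorsion := by
  intro W _ _ N _ D hopt h9 hT
  by_cases hmu : HasShortMuThree W D.c
  · exact hres W D hopt h9 hT hmu
  · exact hgen W D hopt h9 hT hmu

end Summit.BirchSwinnertonDyer.Rank1Residual.ManinAdditive.KatoCurve

end
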